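import Literature.AlgebraicGeometry.Modules.EquivariantStructureRestrictOfPullback
import Literature.AlgebraicGeometry.RelativeSpec.EquivariantModuleDescentUnique
import HarnessLib

/-!
# Descent along a free finite quotient commutes with restriction along an equivariant slice

Layer `Literature/AlgebraicGeometry/RelativeSpec`, namespace `Literature.AlgebraicGeometry.RelativeSpec.ActionOver` (sequel to
★ `RelativeSpec/EquivariantModuleDescentUnique` and to `Modules/EquivariantStructureRestrict(OfPullback)`). THEOREMS ONLY;
no named fact, no instance, no notation. Cell `hodgecm-mathlib` (D-0151), M1PRIME-DAG rung 0, J0a junction, leaf (J0a-3b)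
(B-p07 lineage): Mumford's normalisation `𝒫|_{{0} × X̂} ≅ 𝒪_X̂` of the Poincaré bundle ([MumfordAV1970] §8 pp. 78–80;
[MilneAV2008] I §8 (b)). Banked capital; HC_CM is proved only modulo the 7 printed citations until rung 0 closes.

Setting: a commuting square of schemes `ι ≫ p = p' ≫ ι'` — `p : X → Q` carrying an action `ρ` of `G`, `p' : S → T` an
AFFINE FLAT GEOMETRIC QUOTIENT by a FREE action `τ` of the same `G`, `ι : S → X` equivariant — a finite locally free `E` on
`X` with a `G`-linearisation `Φ`, DESCENDED along `p` to `F` (an isomorphism `e : p^* F ≅ E` intertwining the canonical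
linearisation of `p^* F` with `Φ`, as produced by ★ `ActionOver.exists_descent_of_free`).

* `intertwines_squareIso_symm_trans_map` — the restricted descent datum: `e₁ := squareIso⁻¹ ≫ ι^* e : p'^* ι'^* F ≅ ι^* E`
  intertwines the canonical linearisation of `p'^*(ι'^* F)` with the RESTRICTED linearisation `Φ.restrict` of `ι^* E`
  (`Modules/EquivariantStructureRestrictOfPullback.restrictAlong_ofPullback` + `restrictAlong_conj`);
* **`exists_iso_pullback_descended_of_restrict`** — hence, by uniqueness of descent along `p'` (★ (T2)
  `descent_unique_of_free`), `ι'^* F` is THE descent of `(ι^* E, Φ.restrict)`: it is isomorphic (over `ι^* E`) to any `F₂`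
  on `T` with `p'^* F₂ ≅ ι^* E` intertwining the canonical linearisation with `Φ.restrict`. With `F₂ = 𝒪_T` this is the
  rigidification of the descended bundle along the slice.

## References

* [MumfordAV1970] D. Mumford, *Abelian Varieties* (1970), §7 Prop. 2, §12 Thm. 1 (descent along free quotients), §8 pp. 78–80.
* [MilneAV2008] J. S. Milne, *Abelian Varieties* (2008), I §8 (pp. 36–40).
* [Greither1992CyclicGalois] C. Greither, LNM 1534, Ch. 0 Prop. 7.2 (p. 29) (uniqueness of descended morphisms).
-/

noncomputable section

-- `TopCat.Presheaf`/`Scheme.Modules` are not reducible (as in Mathlib's `AlgebraicGeometry/Modules`).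
set_option backward.isDefEq.respectTransparency false

open CategoryTheory AlgebraicGeometry Opposite TopologicalSpace

universe u

namespace Literature.AlgebraicGeometry.RelativeSpec.ActionOver

open Literature.AlgebraicGeometry.Modules Literature.AlgebraicGeometry.Motives

variable {X S Q T : Scheme.{u}} {p : X ⟶ Q} {p' : S ⟶ T} {G : Type u} [Group G]
  (ρ : ActionOver p G) (τ : ActionOver p' G) (ι : S ⟶ X) (ι' : T ⟶ Q) (hsq : ι ≫ p = p' ≫ ι')
  (hι : ∀ g : G, τ.autHom g ≫ ι = ι ≫ ρ.autHom g)
  {E : X.Modules} (hE : IsFiniteLocallyFree E) (Φ : ρ.EquivariantStructure E)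
  {F : Q.Modules} (hF : IsFiniteLocallyFree F) (e : (Scheme.Modules.pullback p).obj F ≅ E)
  (he : ∀ g : G, (Scheme.Modules.pullback (ρ.autHom g)).map e.hom ≫ (Φ.iso g).hom =
    ((EquivariantStructure.ofPullback ρ F).iso g).hom ≫ e.hom)

include hF he in
/-- **The restricted descent datum intertwines.** With `e₁ := squareIso⁻¹ ≫ ι^* e : p'^* ι'^* F ≅ ι^* E`, for every `g`:
`τ_g^*(e₁) ≫ (Φ.restrict)_g = (ofPullback τ (ι'^* F))_g ≫ e₁`. [cite: MumfordAV1970, §7 (Prop. 2)] -/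
theorem intertwines_squareIso_symm_trans_map (g : G) :
    (Scheme.Modules.pullback (τ.autHom g)).map
          ((squareIso hsq F).symm ≪≫ (Scheme.Modules.pullback ι).mapIso e).hom ≫
        ((Φ.restrict τ ι hι hE).iso g).hom =
      ((EquivariantStructure.ofPullback τ ((Scheme.Modules.pullback ι').obj F)).iso g).hom ≫
        ((squareIso hsq F).symm ≪≫ (Scheme.Modules.pullback ι).mapIso e).hom := by
  -- `Φ_g = σ_g^*(e⁻¹) ≫ can_g ≫ e`
  have hΦ : (Φ.iso g).hom = (Scheme.Modules.pullback (ρ.autHom g)).map e.inv ≫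
      ((EquivariantStructure.ofPullback ρ F).iso g).hom ≫ e.hom := by
    rw [← he, ← Functor.map_comp_assoc, e.inv_hom_id, CategoryTheory.Functor.map_id, Category.id_comp]
  -- the canonical linearisation restricts to the canonical linearisation (K1)
  have hK := restrictAlong_ofPullback ρ τ ι ι' hsq hι hF g
  rw [EquivariantStructure.restrict_iso_hom, hΦ, restrictAlong_conj]
  simp only [Iso.trans_hom, Iso.symm_hom, Functor.mapIso_hom, Functor.map_comp, Category.assoc]
  rw [← Functor.map_comp_assoc (Scheme.Modules.pullback (τ.autHom g)) ((Scheme.Modules.pullback ι).map e.hom),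
    ← Functor.map_comp, e.hom_inv_id, CategoryTheory.Functor.map_id, CategoryTheory.Functor.map_id, Category.id_comp]
  -- from (K1): `τ_g^*(sq⁻¹) ≫ R(can) = can' ≫ sq⁻¹`
  have hK' : (Scheme.Modules.pullback (τ.autHom g)).map (squareIso hsq F).inv ≫
      restrictAlong ρ τ ι hι ((Scheme.Modules.pullback p).obj F) g
        ((EquivariantStructure.ofPullback ρ F).iso g).hom =
      ((EquivariantStructure.ofPullback τ ((Scheme.Modules.pullback ι').obj F)).iso g).hom ≫ (squareIso hsq F).inv := by
    rw [← cancel_mono (squareIso hsq F).hom, Category.assoc, Category.assoc, hK, ← Functor.map_comp_assoc,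
      Iso.inv_hom_id, CategoryTheory.Functor.map_id, Category.id_comp, Category.comp_id]
  rw [reassoc_of% hK']

include hF he in
/-- **Descent commutes with restriction along an equivariant slice** ([MumfordAV1970] §8: the normalisation
`𝒫|_{{0}×X̂}` trivial): if `p'` is an affine flat geometric quotient by the free action `τ` (★ (T2)
`descent_unique_of_free`), then for every quasi-coherent `F₂` on `T` with an isomorphism `e₂ : p'^* F₂ ≅ ι^* E` intertwining
the canonical linearisation with `Φ.restrict`, the restriction `ι'^* F` of the descended module is isomorphic to `F₂`
over `ι^* E`. [cite: MumfordAV1970, §12 Thm. 1 and §8 (pp. 78–80)] [cite: Greither1992CyclicGalois, Ch. 0 Prop. 7.2 (p. 29)] -/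
theorem exists_iso_pullback_descended_of_restrict [Fintype G] [IsAffineHom p'] [Flat p'] (hq : τ.IsGeometricQuotient p')
    (hfree : ∀ (V : T.Opens), IsAffineOpen V → ∀ g : G, g ≠ 1 →
      Ideal.span (Set.range fun b : Γ(S, p' ⁻¹ᵁ V) ↦ τ.act g V b - b) = ⊤)
    [((Scheme.Modules.pullback ι).obj E).IsQuasicoherent]
    (F₂ : T.Modules) (e₂ : (Scheme.Modules.pullback p').obj F₂ ≅ (Scheme.Modules.pullback ι).obj E)
    (he₂ : ∀ g : G, (Scheme.Modules.pullback (τ.autHom g)).map e₂.hom ≫ ((Φ.restrict τ ι hι hE).iso g).hom =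
      ((EquivariantStructure.ofPullback τ F₂).iso g).hom ≫ e₂.hom) :
    ∃ i : (Scheme.Modules.pullback ι').obj F ≅ F₂,
      (Scheme.Modules.pullback p').map i.hom ≫ e₂.hom =
        ((squareIso hsq F).symm ≪≫ (Scheme.Modules.pullback ι).mapIso e).hom :=
  τ.descent_unique_of_free ((Scheme.Modules.pullback ι).obj E) (Φ.restrict τ ι hι hE).iso hq hfree
    (Φ.restrict τ ι hι hE).iso_one_hom (Φ.restrict τ ι hι hE).iso_mul_hom _ F₂ _ e₂
    (intertwines_squareIso_symm_trans_map ρ τ ι ι' hsq hι hE Φ hF e he) he₂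

end Literature.AlgebraicGeometry.RelativeSpec.ActionOver

end
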